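/-
Copyright (c) 2026 the pub-hodgecm-mathlib formalisation cell (harness21).  Prover seat hodgecm-mathlib-F0P2-p09 (g0), re-dealt to L1
`stub_firstTermThetaPairing` (director s1969∕s1970: «p09 → the p20 file»); hLiu418 = `stmt-HodgeConjecture-24832`; I4-conv (F′-fact) FILE D0, part 2 of 2.
-/
import Summits.HodgeConjecture.HodgeConjecture.Theorems.K2LiuRestrictedProductAddHaar   -- ★ D0a (p861152): `isAddLeftInvariant_rpMeasure`, `isAddHaarMeasure_rpMeasure`
import Summits.HodgeConjecture.HodgeConjecture.Theorems.K2LiuKlingenFibreCoordinates     -- part 1: `exists_measurableEquiv_coord`, `coe_pi_integers_eq_integralBox`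
import Mathlib.MeasureTheory.Measure.Haar.Unique
import HarnessLib

/-!
# Crux `HLiu418`, I4-conv (F′-fact), FILE D0 (part 2 of 2) — `K2LiuKlingenFibreHaarPinned`: THE PINNED SPLITTING `(μ_Y ⊗ μ_T) ∘ E⁻¹ = μ ⊗ ∏'_{v∉S} (ν_v ; 𝒪_v³)`
# of the Haar measure of the Klingen fibre `Y(𝔸) × 𝔸_L` — the binder `hmap` of ★ FILE D `K2LiuKlingenInnerSectionEuler.integral_eq_mul_tprod_of_map_eq`

Cell `hodgecm-mathlib`, crux item hLiu418 = `stmt-HodgeConjecture-24832`; squad K2 ∕ K2Liu (re-dealt hand F0P2-p09 (g0), director s1970); LEAD F0P6-plan (g14); spec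
K2Liu-p14 (g3) I4-conv census `K2/K2Liu-p14/g3/CENSUS-I4conv-FprimeFact.K2Liu-p14-g3.md` §2 FILE D0 + TARGET SHAPE 14:47:39Z («`Q := ↥Y × AdeleRing (𝓞 L) L`,
`μQ := μY.prod μT`, `hmap : Measure.map E μQ = μ.prod (rpMeasure K ν ∅)`, index `{v // v ∉ T′}` over the finite places of `L⁺` — any measurable equivalence with that
pushforward will do»).  THEOREMS ONLY (no `def`, no instance, no notation, no named-fact hypothesis, no `sorry`); lane `--supports stmt-HodgeConjecture-24832 --as helper`.

**`exists_measurableEquiv_map_prod_eq_prod_rpMeasure`** — THE PIN.  `Y = {y ∈ 𝔸_L | σ y = −y}` (`hY`), `μ_Y`, `μ_T` additive Haar measures on `Y(𝔸)` and `𝔸_L`, `S` a finite set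
of finite places of `L⁺`, `ν_v` additive Haar measures on `Fin 3 → L⁺_v` with `ν_v(𝒪_v³) = 1` off `S` (the σ-compact local groups make `ν_v` σ-finite).  THEN, with the coordinate
equivalence `E` of part 1 (quadratic coordinates `(b_y ; a_t, b_t)` of `q = (y, t)` read place by place: `y = Ψ(0, b_y)`, `t = Ψ(a_t, b_t)`, `Ψ = ★ quadraticAdeleEquiv L⁺ L σ`;
its three coordinate formulas are repeated in the conclusion, so a consumer discharges ★ FILE D's shape hypothesis `hF : F (E.symm (x, y)) = g x * ∏ᶠ_v φ_v (y v)` from the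
PLACE COMPONENTS of `q = E.symm (x, y)`), there is a σ-finite additive HAAR measure `μ` on `(Fin 3 → L⁺_∞) × Π_{v∈S} (Fin 3 → L⁺_v)` with
  `Measure.map E (μY.prod μT) = μ.prod (rpMeasure (fun v => ↑𝒪_v³) (fun v => ν v) ∅)`.
PROOF.  ★ D0a `isAddHaarMeasure_rpMeasure`: `∏'_{v∉S} (ν_v ; 𝒪_v³)` is an additive Haar measure on `Πʳ_{v∉S} [Fin 3 → L⁺_v, 𝒪_v³]`; the pull-back of `addHaar ⊗ ∏'ν` along the
continuous additive `E` is left-invariant and finite on compacta on the second countable locally compact group `Y(𝔸) × 𝔸_L`, hence `c • (μ_Y ⊗ μ_T)` with `c ≠ 0`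
(Mathlib `isAddLeftInvariant_eq_smul`); push forward by `E` and absorb `c⁻¹` into `μ := c⁻¹ • addHaar`.
[CasselsFrohlichANT1967, Ch. XV (Tate) §3.3 Thm. 3.3.1, Ch. II §14], [BorelJacquet1979, §4.1 (`G(𝔸) = G_∞ × G(𝔸_f)`, `dg = ∏ dg_v`)], [WeilBNT1967, Ch. IV §1–§2].
HONEST LABEL.  Count-neutral helper: `HC_CM` is proved only modulo the 7 printed citations (2 remaining named inputs: hLiu418 = `stmt-HodgeConjecture-24832`,
h413 = `stmt-HodgeConjecture-24833`) until rung 0 closes; this file closes no socket by itself.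

## Mathlib ∕ tree search
Tree ★: part 1 `K2LiuKlingenFibreCoordinates.{exists_measurableEquiv_coord, coe_pi_integers_eq_integralBox}`, D0a `K2LiuRestrictedProductAddHaar.isAddHaarMeasure_rpMeasure`,
`FiniteAdeleFactorizable.{isOpen_integralBox, isCompact_integralBox}`, `RestrictedProduct.{ProductMeasure.rpMeasure, Borel.borelSpace, Borel.secondCountableTopology}`,
`AdelicSecondCountable.*`, `AdicCompletionCompact.locallyCompactSpace_adeleRing'`, `UnitaryGroupOfFormAdelicTopology.continuous_conjAdele`.  Mathlib: `Measure.addHaar`,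
`Measure.prod.instIsAddHaarMeasure`, `Measure.isAddLeftInvariant_eq_smul`, `MeasurableEquiv.{map_map_symm, image_eq_preimage_symm}`, `Measure.prod_smul_left`,
`IsAddHaarMeasure.smul`.  Dedup: `rg "map_prod_eq_prod_rpMeasure|KlingenFibreHaar" Summits/ Literature/` — none (★ Φ3b `K2LiuSiegelUnipotentHaarPinned` is the multiplicative
model for `N_Δ(𝔸)`).

## References
* [CasselsFrohlichANT1967] J. W. S. Cassels, A. Fröhlich (eds.), *Algebraic Number Theory* (1967), Ch. II (Cassels) §14; Ch. XV (Tate) §3.3.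
* [BorelJacquet1979] A. Borel, H. Jacquet, *Automorphic forms and automorphic representations*, PSPM 33.1 (1979), §4.1.
* [WeilBNT1967] A. Weil, *Basic Number Theory* (1967), Ch. IV §1–§2.
-/

set_option autoImplicit false
set_option linter.dupNamespace false -- the mandated namespace repeats `HodgeConjecture.HodgeConjecture`

noncomputable section

open scoped RestrictedProduct ENNReal NNReal Topology
open NumberField IsDedekindDomain MeasureTheory Measure Filter Set

namespace Summit.HodgeConjecture.HodgeConjecture.Cruxes.HLiu418.K2LiuKlingenFibreHaarPinned

open Literature.NumberTheory.Automorphic Literature.NumberTheory.Automorphic.UnitaryGroup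
open Literature.NumberTheory.GelbartRogawski1991.GRConstruction (Fp)
open Literature.MeasureTheory.RestrictedProduct
open Summit.HodgeConjecture.HodgeConjecture.Cruxes.HLiu418.K2LiuRestrictedProductAddHaar
open Summit.HodgeConjecture.HodgeConjecture.Cruxes.HLiu418.K2LiuKlingenFibreCoordinates

/-! ## §3 The pinned splitting of the Haar measure of the Klingen fibre -/

section Pinned

variable (L : Type) [Field L] [NumberField L] [IsCMField L]

/-- **PINNED SPLITTING OF THE HAAR MEASURE OF THE KLINGEN FIBRE `Y(𝔸) × 𝔸_L` (the binder `hmap` of ★ FILE D `K2LiuKlingenInnerSectionEuler`).**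
`Y = {y ∈ 𝔸_L | σ y = −y}` (`hY`), `μ_Y`, `μ_T` additive Haar measures on `Y(𝔸)` and `𝔸_L`, `S` a finite set of finite places of `L⁺`, `ν_v` additive Haar measures on
`L⁺_v³ = Fin 3 → L⁺_v` with `ν_v(𝒪_v³) = 1` off `S`.  THEN, with the coordinate equivalence `E` of §2 (quadratic coordinates `(b_y ; a_t, b_t)` read place by place;
its three coordinate formulas are part of the conclusion), there is a σ-finite additive HAAR measure `μ` on `(Fin 3 → L⁺_∞) × Π_{v∈S} (Fin 3 → L⁺_v)` with
  `(μ_Y ⊗ μ_T) ∘ E⁻¹ = μ ⊗ ∏'_{v∉S} (ν_v ; 𝒪_v³)`   (`Measure.map E (μY.prod μT) = μ.prod (rpMeasure _ _ ∅)`).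
Proof: `∏'(ν_v ; 𝒪_v³)` is an additive Haar measure (D0a `isAddHaarMeasure_rpMeasure`), so the pull-back of `addHaar ⊗ ∏'ν` along the continuous additive `E` is
left-invariant and finite on compacta on the second countable locally compact group `Y(𝔸) × 𝔸_L`, hence a scalar multiple of `μ_Y ⊗ μ_T` (Mathlib
`isAddLeftInvariant_eq_smul`); the scalar is absorbed into `μ`. [cite: CasselsFrohlichANT1967, Ch. XV (Tate) §3.3 Thm. 3.3.1] [cite: BorelJacquet1979, §4.1] [cite: WeilBNT1967, Ch. IV §1] -/
theorem exists_measurableEquiv_map_prod_eq_prod_rpMeasure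
    [MeasurableSpace (AdeleRing (𝓞 L) L)] [BorelSpace (AdeleRing (𝓞 L) L)]
    [MeasurableSpace (InfiniteAdeleRing (Fp L))] [BorelSpace (InfiniteAdeleRing (Fp L))]
    [∀ v : HeightOneSpectrum (𝓞 (Fp L)), MeasurableSpace (v.adicCompletion (Fp L))] [∀ v : HeightOneSpectrum (𝓞 (Fp L)), BorelSpace (v.adicCompletion (Fp L))]
    {δ : L} (hσδ : IsCMField.complexConj L δ = -δ) (hδ : δ ≠ 0)
    (Y : AddSubgroup (AdeleRing (𝓞 L) L)) (hY : ∀ y, y ∈ Y ↔ conjAdele (Fp L) L (IsCMField.complexConj L) y = -y)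
    (μY : Measure ↥Y) (μT : Measure (AdeleRing (𝓞 L) L)) [μY.IsAddHaarMeasure] [μT.IsAddHaarMeasure]
    (S : Finset (HeightOneSpectrum (𝓞 (Fp L))))
    (ν : ∀ v : HeightOneSpectrum (𝓞 (Fp L)), Measure (Fin 3 → v.adicCompletion (Fp L))) [∀ v, (ν v).IsAddHaarMeasure] [∀ v, SigmaFinite (ν v)]
    (hν : ∀ v, v ∉ S → ν v ((AddSubgroup.pi Set.univ (fun _ : Fin 3 => (v.adicCompletionIntegers (Fp L)).toSubring.toAddSubgroup) :
      AddSubgroup (Fin 3 → v.adicCompletion (Fp L))) : Set (Fin 3 → v.adicCompletion (Fp L))) = 1) :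
    ∃ E : (↥Y × AdeleRing (𝓞 L) L) ≃ᵐ
        ((Fin 3 → InfiniteAdeleRing (Fp L)) × (Π v : S, Fin 3 → v.1.adicCompletion (Fp L))) ×
        (Πʳ v : {v : HeightOneSpectrum (𝓞 (Fp L)) // v ∉ S},
          [Fin 3 → v.1.adicCompletion (Fp L), (AddSubgroup.pi Set.univ (fun _ : Fin 3 => (v.1.adicCompletionIntegers (Fp L)).toSubring.toAddSubgroup) :
            AddSubgroup (Fin 3 → v.1.adicCompletion (Fp L)))]),
      (∀ q, (E q).1.1 = ![((quadraticAdeleEquiv (Fp L) L (IsCMField.complexConj L) hσδ hδ).symm (q.1 : AdeleRing (𝓞 L) L)).2.1,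
        ((quadraticAdeleEquiv (Fp L) L (IsCMField.complexConj L) hσδ hδ).symm q.2).1.1,
        ((quadraticAdeleEquiv (Fp L) L (IsCMField.complexConj L) hσδ hδ).symm q.2).2.1]) ∧
      (∀ q (v : S), (E q).1.2 v = ![((quadraticAdeleEquiv (Fp L) L (IsCMField.complexConj L) hσδ hδ).symm (q.1 : AdeleRing (𝓞 L) L)).2.2 v.1,
        ((quadraticAdeleEquiv (Fp L) L (IsCMField.complexConj L) hσδ hδ).symm q.2).1.2 v.1,
        ((quadraticAdeleEquiv (Fp L) L (IsCMField.complexConj L) hσδ hδ).symm q.2).2.2 v.1]) ∧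
      (∀ q (v : {v : HeightOneSpectrum (𝓞 (Fp L)) // v ∉ S}), (E q).2 v =
        ![((quadraticAdeleEquiv (Fp L) L (IsCMField.complexConj L) hσδ hδ).symm (q.1 : AdeleRing (𝓞 L) L)).2.2 v.1,
          ((quadraticAdeleEquiv (Fp L) L (IsCMField.complexConj L) hσδ hδ).symm q.2).1.2 v.1,
          ((quadraticAdeleEquiv (Fp L) L (IsCMField.complexConj L) hσδ hδ).symm q.2).2.2 v.1]) ∧
      ∃ μ : Measure ((Fin 3 → InfiniteAdeleRing (Fp L)) × (Π v : S, Fin 3 → v.1.adicCompletion (Fp L))),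
        μ.IsAddHaarMeasure ∧ SigmaFinite μ ∧
        Measure.map E (μY.prod μT) =
          μ.prod (rpMeasure
            (fun v : {v : HeightOneSpectrum (𝓞 (Fp L)) // v ∉ S} =>
              ((AddSubgroup.pi Set.univ (fun _ : Fin 3 => (v.1.adicCompletionIntegers (Fp L)).toSubring.toAddSubgroup) :
                AddSubgroup (Fin 3 → v.1.adicCompletion (Fp L))) : Set (Fin 3 → v.1.adicCompletion (Fp L))))
            (fun v => ν v.1) ∅) := by
  classical
  obtain ⟨E, hEc, hEadd, hE1, hE2, hE3⟩ := exists_measurableEquiv_coord L hσδ hδ Y hY S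
  -- point-set instances
  haveI : Countable (HeightOneSpectrum (𝓞 (Fp L))) := countable_heightOneSpectrum (Fp L)
  haveI : ∀ v : HeightOneSpectrum (𝓞 (Fp L)), SecondCountableTopology (v.adicCompletion (Fp L)) :=
    fun v => secondCountableTopology_adicCompletion (Fp L) v
  haveI : SecondCountableTopology (InfiniteAdeleRing (Fp L)) := secondCountableTopology_infiniteAdeleRing (Fp L)
  haveI : SecondCountableTopology (AdeleRing (𝓞 L) L) := secondCountableTopology_adeleRing L
  haveI : LocallyCompactSpace (AdeleRing (𝓞 L) L) := locallyCompactSpace_adeleRing' L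
  haveI : T2Space (InfiniteAdeleRing L) := inferInstanceAs (T2Space ((w : InfinitePlace L) → w.Completion))
  haveI : T2Space (FiniteAdeleRing (𝓞 L) L) :=
    inferInstanceAs (T2Space (RestrictedProduct (fun w : HeightOneSpectrum (𝓞 L) => w.adicCompletion L)
      (fun w => (w.adicCompletionIntegers L : Set (w.adicCompletion L))) Filter.cofinite))
  haveI : T2Space (AdeleRing (𝓞 L) L) := inferInstanceAs (T2Space (InfiniteAdeleRing L × FiniteAdeleRing (𝓞 L) L))
  have hYc : IsClosed (Y : Set (AdeleRing (𝓞 L) L)) := by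
    have h : (Y : Set (AdeleRing (𝓞 L) L)) = {y | conjAdele (Fp L) L (IsCMField.complexConj L) y = -y} := Set.ext fun y => hY y
    rw [h]
    exact isClosed_eq (continuous_conjAdele (Fp L) L (IsCMField.complexConj L)) continuous_neg
  haveI : LocallyCompactSpace ↥Y := hYc.isClosedEmbedding_subtypeVal.locallyCompactSpace
  haveI : SecondCountableTopology ↥Y := TopologicalSpace.Subtype.secondCountableTopology _
  haveI : BorelSpace (↥Y × AdeleRing (𝓞 L) L) := Prod.borelSpace
  haveI hKo : Fact (∀ v : {v : HeightOneSpectrum (𝓞 (Fp L)) // v ∉ S},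
      IsOpen ((AddSubgroup.pi Set.univ (fun _ : Fin 3 => (v.1.adicCompletionIntegers (Fp L)).toSubring.toAddSubgroup) :
        AddSubgroup (Fin 3 → v.1.adicCompletion (Fp L))) : Set (Fin 3 → v.1.adicCompletion (Fp L)))) :=
    ⟨fun v => by rw [coe_pi_integers_eq_integralBox]; exact isOpen_integralBox (Fp L) (Fin 3) v.1⟩
  have hKc : ∀ v : {v : HeightOneSpectrum (𝓞 (Fp L)) // v ∉ S},
      IsCompact ((AddSubgroup.pi Set.univ (fun _ : Fin 3 => (v.1.adicCompletionIntegers (Fp L)).toSubring.toAddSubgroup) :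
        AddSubgroup (Fin 3 → v.1.adicCompletion (Fp L))) : Set (Fin 3 → v.1.adicCompletion (Fp L))) :=
    fun v => by rw [coe_pi_integers_eq_integralBox]; exact isCompact_integralBox (Fp L) (Fin 3) v.1
  haveI : BorelSpace (Πʳ v : {v : HeightOneSpectrum (𝓞 (Fp L)) // v ∉ S},
      [Fin 3 → v.1.adicCompletion (Fp L), (AddSubgroup.pi Set.univ (fun _ : Fin 3 => (v.1.adicCompletionIntegers (Fp L)).toSubring.toAddSubgroup) :
        AddSubgroup (Fin 3 → v.1.adicCompletion (Fp L)))]) :=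
    borelSpace (fun v : {v : HeightOneSpectrum (𝓞 (Fp L)) // v ∉ S} =>
      ((AddSubgroup.pi Set.univ (fun _ : Fin 3 => (v.1.adicCompletionIntegers (Fp L)).toSubring.toAddSubgroup) :
        AddSubgroup (Fin 3 → v.1.adicCompletion (Fp L))) : Set (Fin 3 → v.1.adicCompletion (Fp L)))) (fun v => (hKo.out v).measurableSet)
  haveI : SecondCountableTopology (Πʳ v : {v : HeightOneSpectrum (𝓞 (Fp L)) // v ∉ S},
      [Fin 3 → v.1.adicCompletion (Fp L), (AddSubgroup.pi Set.univ (fun _ : Fin 3 => (v.1.adicCompletionIntegers (Fp L)).toSubring.toAddSubgroup) :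
        AddSubgroup (Fin 3 → v.1.adicCompletion (Fp L)))]) :=
    secondCountableTopology (fun v : {v : HeightOneSpectrum (𝓞 (Fp L)) // v ∉ S} =>
      ((AddSubgroup.pi Set.univ (fun _ : Fin 3 => (v.1.adicCompletionIntegers (Fp L)).toSubring.toAddSubgroup) :
        AddSubgroup (Fin 3 → v.1.adicCompletion (Fp L))) : Set (Fin 3 → v.1.adicCompletion (Fp L)))) hKo.out
  -- the restricted product of the local Haar measures is an additive Haar measure (D0a)
  obtain ⟨hRH, hRσ, -⟩ := isAddHaarMeasure_rpMeasure
    (fun v : {v : HeightOneSpectrum (𝓞 (Fp L)) // v ∉ S} =>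
      (AddSubgroup.pi Set.univ (fun _ : Fin 3 => (v.1.adicCompletionIntegers (Fp L)).toSubring.toAddSubgroup) :
        AddSubgroup (Fin 3 → v.1.adicCompletion (Fp L))))
    (fun v => ν v.1) hKc (fun v => hν v.1 v.2)
  haveI := hRH
  haveI := hRσ
  -- the reference Haar measure on the `X`-part and the pulled-back measure on the fibre
  haveI : BorelSpace ((Fin 3 → InfiniteAdeleRing (Fp L)) × (Π v : S, Fin 3 → v.1.adicCompletion (Fp L))) := Prod.borelSpace
  set μX : Measure ((Fin 3 → InfiniteAdeleRing (Fp L)) × (Π v : S, Fin 3 → v.1.adicCompletion (Fp L))) := Measure.addHaar with hμX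
  set μR := rpMeasure
    (fun v : {v : HeightOneSpectrum (𝓞 (Fp L)) // v ∉ S} =>
      ((AddSubgroup.pi Set.univ (fun _ : Fin 3 => (v.1.adicCompletionIntegers (Fp L)).toSubring.toAddSubgroup) :
        AddSubgroup (Fin 3 → v.1.adicCompletion (Fp L))) : Set (Fin 3 → v.1.adicCompletion (Fp L))))
    (fun v => ν v.1) ∅ with hμR
  haveI : (μX.prod μR).IsAddHaarMeasure := prod.instIsAddHaarMeasure μX μR
  haveI : (μY.prod μT).IsAddHaarMeasure := prod.instIsAddHaarMeasure μY μT
  set lam : Measure (↥Y × AdeleRing (𝓞 L) L) := (μX.prod μR).map E.symm with hlam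
  have hlam_inv : lam.IsAddLeftInvariant := by
    refine ⟨fun q₀ => ?_⟩
    rw [hlam, Measure.map_map (measurable_const_add q₀) E.symm.measurable]
    have hcomp : ((q₀ + ·) ∘ E.symm : _ → ↥Y × AdeleRing (𝓞 L) L) = E.symm ∘ (E q₀ + ·) := by
      funext z
      apply E.injective
      show E (q₀ + E.symm z) = E (E.symm (E q₀ + z))
      rw [hEadd, E.apply_symm_apply, E.apply_symm_apply]
    rw [hcomp, ← Measure.map_map E.symm.measurable (measurable_const_add (E q₀)), map_add_left_eq_self]
  have hlam_fin : IsFiniteMeasureOnCompacts lam := ⟨fun K hK => by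
    rw [hlam, Measure.map_apply E.symm.measurable hK.measurableSet, ← MeasurableEquiv.image_eq_preimage_symm]
    exact (hK.image hEc).measure_lt_top⟩
  haveI := hlam_inv
  haveI := hlam_fin
  obtain ⟨c, hc⟩ : ∃ c : ℝ≥0, lam = c • (μY.prod μT) := ⟨_, isAddLeftInvariant_eq_smul lam (μY.prod μT)⟩
  have hc0 : c ≠ 0 := by
    rintro rfl
    rw [zero_smul] at hc
    have h1 : lam Set.univ = 0 := by rw [hc]; rfl
    rw [hlam, Measure.map_apply E.symm.measurable MeasurableSet.univ, Set.preimage_univ] at h1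
    exact (NeZero.ne ((μX.prod μR) Set.univ)) h1
  have hmapE : Measure.map E lam = μX.prod μR := by
    rw [hlam]
    exact MeasurableEquiv.map_map_symm E
  haveI hμ : (((c⁻¹ : ℝ≥0) : ℝ≥0∞) • μX).IsAddHaarMeasure := IsAddHaarMeasure.smul μX (by simpa using hc0) ENNReal.coe_ne_top
  refine ⟨E, hE1, hE2, hE3, ((c⁻¹ : ℝ≥0) : ℝ≥0∞) • μX, hμ, inferInstance, ?_⟩
  rw [Measure.prod_smul_left, ← hmapE, hc, Measure.map_smul, ← ENNReal.smul_def, smul_smul, inv_mul_cancel₀ hc0, one_smul]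

end Pinned

end Summit.HodgeConjecture.HodgeConjecture.Cruxes.HLiu418.K2LiuKlingenFibreHaarPinned

end
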